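import Summits.HubbardSuperconductivity.HubbardSuperconductivity.Theses.FunctionFieldCertificate
import Summits.HubbardSuperconductivity.HubbardSuperconductivity.Theorems.FunctionFieldCertificateWindowInfraredBoundReductions
import Summits.HubbardSuperconductivity.HubbardSuperconductivity.Theorems.FunctionFieldCertificateWindowInfraredBoundGoldstoneOfPgd
import Summits.HubbardSuperconductivity.HubbardSuperconductivity.Theorems.FunctionFieldCertificateMesoscopicPairOrderSplit
import Literature.MathematicalPhysics.QuantumLattice.PairFieldMomentum
import HarnessLib

/-!
# `MesoscopicPairOrder` (stmt-HubbardSuperconductivity-7331), line `pointwise_split` —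
# the position of sub-crux (A) `GoldstonePairProfile` relative to the pole half (stmt-1089)

Sub-crux (A) of the split `MesoscopicPairOrder ⇐ (A) ∧ (B)` (glue `mesoscopicPairOrder_of_subs`,
`Theorems/FunctionFieldCertificateMesoscopicPairOrderSplit.lean`) is the GOLDSTONE PAIR PROFILE: at every
`U > 0`, `δ ∈ (0, 1/2)` there are `S, A ≥ 0`, `L₀` such that every normalised `(N_L, S^z = 0)`-sector
ground state `ψ` of `hubbardTorus 2 L 1 U` on every even torus `L ≥ L₀` has
`S_ψ(m) ≤ S + A/|q_m|` for all momentum labels `m ≠ 0`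
(`S_ψ = pairStructureFactor dWaveFormFactor L ψ`, `|q_m| = √(momentumNormSq L m)`).
It is OPEN physics (no reflection-positivity-free `T = 0` infrared bound is known for any quantum lattice
model; `Cruxes/WindowInfraredBound/STRATEGY-CENSUS.md`). This support file (sorry-free, no definition,
no named fact; nothing here claims (A)) records its exact kernel-checked position:

* `goldstonePairProfile_iff_shape_and_flat` (registered one-line form
  `goldstonePairProfileIffShapeAndFlat`) — **(A) ⟺ (GS) ∧ (OffWindowFlat)**, where
  (GS) is VERBATIM the hypothesis of the landed `wib_of_goldstoneShape` (the pointwise Goldstone shape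
  `S_ψ(m)·|q_m| ≤ A` on a window `0 < |q_m| ≤ ε₀`; it is the OUTPUT of the stmt-1089 engine
  `WindowInfraredBound.goldstoneShape_of_pairGaussianDomination_of_chargingFloor`, whose inputs
  `stub_pairGaussianDomination` (C⁺_λ) and `stub_chargingFloor` (Ch) are the open physics) and
  (OffWindowFlat) is the flat law `S_ψ(m) ≤ S(η)` off every window `|q_m| > η` (no pair-density-wave
  Bragg peak at a FIXED nonzero momentum; no item carries it yet).
  (⇒) window `ε₀ = 1`, `A ↦ S + A` (`S_ψ·|q| ≤ S|q| + A ≤ S + A` for `|q| ≤ 1`, the computation of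
  `windowInfraredBound_of_goldstonePairProfile`), and `S(η) = S + A/η`; (⇐) `S := S(ε₀)`, `A := A`,
  `L₀ := max` of the two thresholds.
* `goldstonePairProfile_iff_globalShape` — since `|q_m|² ≤ 2π²` on the torus
  (`momentumNormSq_le_two_mul_pi_sq`), (A) is ALSO exactly (GS) with the window removed:
  `∃ A ∀ … ∀ m ≠ 0, S_ψ(m)·|q_m| ≤ A`. So (A) = "window-free Goldstone shape" ⊋ (GS) ⊋ `WindowInfraredBound`.
* `goldstonePairProfile_of_pgd_of_chargingFloor_of_offWindowFlat` — **C⁺_λ → (Ch) → (OffWindowFlat) → (A)**: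
  the three open hypotheses (A) hinges on, by name (the first two verbatim the stmt-1089 line stubs).
* `goldstonePairProfile_of_globalPgd_of_chargingFloor` — **zone-wide C⁺_λ → (Ch) → (A)**: with the window
  clause `|q_m| ≤ η` of `stub_pairGaussianDomination` DROPPED (Gaussian domination at every nonzero momentum,
  the scope reflection positivity delivers where available), (Ch) and the landed engine's pointwise core
  (`WindowInfraredBound.goldstoneShape_of_regularisedClosure`, fed `η := √(2π²)`, which covers the zone) give
  the global shape, i.e. (A) with `S = 0`: no physics input beyond the stmt-1089 line's two stubs.
((A) → `WindowInfraredBound` itself is the Split file's `windowInfraredBound_of_goldstonePairProfile`.)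

Sources: Kennedy–Lieb–Shastry, PRL 61 (1988) 2582 (infrared-bound shape); Pitaevskii–Stringari,
J. Low Temp. Phys. 85 (1991) 377; Scalapino, Phys. Rep. 250 (1995) 329 §2. Folklore bookkeeping.
-/

noncomputable section

-- the summit namespace repeats the problem name by design (D-0017)
set_option linter.dupNamespace false

namespace Summit.HubbardSuperconductivity.HubbardSuperconductivity.Theorems.FunctionFieldCertificate

open Matrix Finset Filter
open Literature.Probability.LatticeModels Literature.MathematicalPhysics.QuantumLattice
open Summit.HubbardSuperconductivity.HubbardSuperconductivity.Theses.FunctionFieldCertificate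
open scoped ComplexOrder

variable {L : ℕ} [NeZero L]

/-! ### Pointwise bookkeeping (one side `L`, one function on the momentum labels; model-free) -/

/-- **A-priori range of the torus momenta**: `|q_m|² ≤ 2π²` for every label `m ∈ (ℤ/Lℤ)²`
(each reduced coordinate satisfies `-L < 2·valMinAbs mᵢ ≤ L`, `ZMod.valMinAbs_mem_Ioc`). [folklore] -/
theorem momentumNormSq_le_two_mul_pi_sq (m : TorusSite 2 L) :
    momentumNormSq L m ≤ 2 * Real.pi ^ 2 := by
  have hL : (0 : ℝ) < L := Nat.cast_pos.2 (Nat.pos_of_ne_zero (NeZero.ne L))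
  have hcoord : ∀ i : Fin 2, (((m i).valMinAbs : ℤ) : ℝ) ^ 2 ≤ (L : ℝ) ^ 2 / 4 := by
    intro i
    have h := ZMod.valMinAbs_mem_Ioc (m i)
    have h1 : (-(L : ℝ)) < ((m i).valMinAbs : ℝ) * 2 := by exact_mod_cast h.1
    have h2 : ((m i).valMinAbs : ℝ) * 2 ≤ (L : ℝ) := by exact_mod_cast h.2
    nlinarith
  have hsum : ∑ i : Fin 2, (((m i).valMinAbs : ℤ) : ℝ) ^ 2 ≤ (L : ℝ) ^ 2 / 2 := by
    calc ∑ i : Fin 2, (((m i).valMinAbs : ℤ) : ℝ) ^ 2 ≤ ∑ _i : Fin 2, (L : ℝ) ^ 2 / 4 :=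
          Finset.sum_le_sum fun i _ => hcoord i
      _ = (L : ℝ) ^ 2 / 2 := by rw [Finset.sum_const, Finset.card_univ, Fintype.card_fin]; ring
  rw [momentumNormSq_apply]
  calc (2 * Real.pi / (L : ℝ)) ^ 2 * ∑ i : Fin 2, (((m i).valMinAbs : ℤ) : ℝ) ^ 2
      ≤ (2 * Real.pi / (L : ℝ)) ^ 2 * ((L : ℝ) ^ 2 / 2) :=
        mul_le_mul_of_nonneg_left hsum (sq_nonneg _)
    _ = 2 * Real.pi ^ 2 := by field_simp

/-- `|q_m| > 0` for `m ≠ 0` (`momentumNormSq_eq_zero_iff`). [folklore] -/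
theorem sqrt_momentumNormSq_pos {m : TorusSite 2 L} (hm : m ≠ 0) :
    0 < Real.sqrt (momentumNormSq L m) :=
  Real.sqrt_pos.2 ((momentumNormSq_nonneg m).lt_of_ne' fun h => hm ((momentumNormSq_eq_zero_iff m).1 h))

/-- **Profile ⇒ shape on a window.** If `f m ≤ S + A/|q_m|` (`S ≥ 0`) at a label `m ≠ 0` with
`|q_m| ≤ ε₀` (`ε₀ ≥ 0`), then `f m · |q_m| ≤ S ε₀ + A`: multiply out, `S|q_m| + A ≤ Sε₀ + A`. [folklore] -/
theorem mul_sqrt_le_of_profile {S A ε₀ : ℝ} (hS : 0 ≤ S) (hε₀ : 0 ≤ ε₀) (f : TorusSite 2 L → ℝ)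
    {m : TorusSite 2 L} (hm : m ≠ 0) (hq : momentumNormSq L m ≤ ε₀ ^ 2)
    (hprof : f m ≤ S + A / Real.sqrt (momentumNormSq L m)) :
    f m * Real.sqrt (momentumNormSq L m) ≤ S * ε₀ + A := by
  have hr := sqrt_momentumNormSq_pos hm
  have hrε : Real.sqrt (momentumNormSq L m) ≤ ε₀ := by
    rw [← Real.sqrt_sq hε₀]
    exact Real.sqrt_le_sqrt hq
  calc f m * Real.sqrt (momentumNormSq L m)
      ≤ (S + A / Real.sqrt (momentumNormSq L m)) * Real.sqrt (momentumNormSq L m) :=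
        mul_le_mul_of_nonneg_right hprof hr.le
    _ = S * Real.sqrt (momentumNormSq L m) + A := by field_simp
    _ ≤ S * ε₀ + A := by nlinarith

omit [NeZero L] in
/-- **Profile ⇒ flat off a window.** If `f m ≤ S + A/|q_m|` for all `m ≠ 0` (`A ≥ 0`), then off the
window of radius `η > 0`, i.e. for `|q_m| > η`, `f m ≤ S + A/η` (such `m` are automatically nonzero). [folklore] -/
theorem le_of_profile_of_sq_lt {S A η : ℝ} (hA : 0 ≤ A) (hη : 0 < η) (f : TorusSite 2 L → ℝ)
    (hprof : ∀ m : TorusSite 2 L, m ≠ 0 → f m ≤ S + A / Real.sqrt (momentumNormSq L m))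
    {m : TorusSite 2 L} (hq : η ^ 2 < momentumNormSq L m) : f m ≤ S + A / η := by
  have hm0 : m ≠ 0 := by
    rintro rfl
    rw [momentumNormSq_zero] at hq
    nlinarith [sq_nonneg η]
  have hr : η < Real.sqrt (momentumNormSq L m) := by
    rw [← Real.sqrt_sq hη.le]
    exact Real.sqrt_lt_sqrt (sq_nonneg _) hq
  have h1 : A / Real.sqrt (momentumNormSq L m) ≤ A / η := div_le_div_of_nonneg_left hA hη hr.le
  exact (hprof m hm0).trans (by linarith)

/-- **Shape on a window + flat off it ⇒ profile.** If `f m · |q_m| ≤ A` for `0 < |q_m| ≤ ε₀` and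
`f m ≤ S` for `|q_m| > ε₀` (`S, A ≥ 0`), then `f m ≤ S + A/|q_m|` for every `m ≠ 0`. [folklore] -/
theorem profile_of_shape_of_flat {S A ε₀ : ℝ} (hS : 0 ≤ S) (hA : 0 ≤ A) (f : TorusSite 2 L → ℝ)
    (hshape : ∀ m : TorusSite 2 L, m ≠ 0 → momentumNormSq L m ≤ ε₀ ^ 2 →
      f m * Real.sqrt (momentumNormSq L m) ≤ A)
    (hflat : ∀ m : TorusSite 2 L, ε₀ ^ 2 < momentumNormSq L m → f m ≤ S)
    {m : TorusSite 2 L} (hm : m ≠ 0) : f m ≤ S + A / Real.sqrt (momentumNormSq L m) := by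
  have hr := sqrt_momentumNormSq_pos hm
  have hAr : 0 ≤ A / Real.sqrt (momentumNormSq L m) := div_nonneg hA hr.le
  by_cases hq : momentumNormSq L m ≤ ε₀ ^ 2
  · have h := hshape m hm hq
    rw [← le_div_iff₀ hr] at h
    linarith
  · push Not at hq
    linarith [hflat m hq]

/-! ### (A) ⟺ (GS) ∧ (OffWindowFlat) -/

/-- **The position of sub-crux (A) relative to the stmt-1089 engines: (A) ⟺ (GS) ∧ (OffWindowFlat).**
(A) `GoldstonePairProfile` (verbatim the registered stub `stub_goldstonePairProfile` of line
`pointwise_split`) is equivalent to the conjunction of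
(GS) the pointwise Goldstone shape on a window — VERBATIM the hypothesis of `wib_of_goldstoneShape` and the
conclusion of `WindowInfraredBound.goldstoneShape_of_pairGaussianDomination_of_chargingFloor` — and
(OffWindowFlat) a flat bound `S_ψ(m) ≤ S(η)` off every window `|q_m| > η`, eventually in even `L`, in every
normalised sector ground state.
(⇒) `ε₀ = 1`, shape constant `S + A`, flat constant `S + A/η`; (⇐) with `(A₁, ε₀, L₁)` from (GS) and
`(S, L₂)` from flatness at `η := ε₀`: `S_ψ ≤ A₁/|q| ≤ S + A₁/|q|` on the punctured window (`|q_m| > 0` for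
`m ≠ 0`), `S_ψ ≤ S ≤ S + A₁/|q|` off it, for `L ≥ max L₁ L₂`. [folklore] -/
theorem goldstonePairProfile_iff_shape_and_flat :
    (∀ U : ℝ, 0 < U → ∀ δ ∈ Set.Ioo (0:ℝ) (1 / 2), ∃ S A : ℝ, 0 ≤ S ∧ 0 ≤ A ∧ ∃ L₀ : ℕ,
      ∀ (L : ℕ) [NeZero L], L₀ ≤ L → Even L →
        ∀ ψ : Fock (Orb (FermionTorus 2 L)), star ψ ⬝ᵥ ψ = 1 →
          IsGroundStateInSector (hubbardTorus 2 L 1 U) (2 * ⌊(1 - δ) * (L : ℝ) ^ 2 / 2⌋₊) 0 ψ →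
            ∀ m : TorusSite 2 L, m ≠ 0 →
              pairStructureFactor dWaveFormFactor L ψ m ≤ S + A / Real.sqrt (momentumNormSq L m)) ↔
    ((∀ U : ℝ, 0 < U → ∀ δ ∈ Set.Ioo (0:ℝ) (1 / 2), ∃ A ε₀ : ℝ, 0 ≤ A ∧ 0 < ε₀ ∧ ∃ L₀ : ℕ,
      ∀ (L : ℕ) [NeZero L], L₀ ≤ L → Even L → ∀ ψ : Fock (Orb (FermionTorus 2 L)),
        star ψ ⬝ᵥ ψ = 1 →
          IsGroundStateInSector (hubbardTorus 2 L 1 U) (2 * ⌊(1 - δ) * (L : ℝ) ^ 2 / 2⌋₊) 0 ψ →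
            ∀ m : TorusSite 2 L, m ≠ 0 → momentumNormSq L m ≤ ε₀ ^ 2 →
              pairStructureFactor dWaveFormFactor L ψ m * Real.sqrt (momentumNormSq L m) ≤ A) ∧
     (∀ U : ℝ, 0 < U → ∀ δ ∈ Set.Ioo (0:ℝ) (1 / 2), ∀ η : ℝ, 0 < η → ∃ S : ℝ, 0 ≤ S ∧ ∃ L₀ : ℕ,
      ∀ (L : ℕ) [NeZero L], L₀ ≤ L → Even L → ∀ ψ : Fock (Orb (FermionTorus 2 L)),
        star ψ ⬝ᵥ ψ = 1 →
          IsGroundStateInSector (hubbardTorus 2 L 1 U) (2 * ⌊(1 - δ) * (L : ℝ) ^ 2 / 2⌋₊) 0 ψ →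
            ∀ m : TorusSite 2 L, η ^ 2 < momentumNormSq L m →
              pairStructureFactor dWaveFormFactor L ψ m ≤ S)) := by
  constructor
  · intro hA
    refine ⟨fun U hU δ hδ => ?_, fun U hU δ hδ η hη => ?_⟩
    · obtain ⟨S, A, hS, hA0, L₀, hprof⟩ := hA U hU δ hδ
      refine ⟨S + A, 1, by positivity, one_pos, L₀, fun L _ hL hE ψ hψ hgs m hm0 hm1 => ?_⟩
      have h := mul_sqrt_le_of_profile hS zero_le_one (pairStructureFactor dWaveFormFactor L ψ) hm0 hm1
        (hprof L hL hE ψ hψ hgs m hm0)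
      linarith
    · obtain ⟨S, A, hS, hA0, L₀, hprof⟩ := hA U hU δ hδ
      refine ⟨S + A / η, by positivity, L₀, fun L _ hL hE ψ hψ hgs m hq => ?_⟩
      exact le_of_profile_of_sq_lt hA0 hη (pairStructureFactor dWaveFormFactor L ψ)
        (hprof L hL hE ψ hψ hgs) hq
  · rintro ⟨hGS, hFlat⟩ U hU δ hδ
    obtain ⟨A, ε₀, hA0, hε₀, L₁, hshape⟩ := hGS U hU δ hδ
    obtain ⟨S, hS, L₂, hflat⟩ := hFlat U hU δ hδ ε₀ hε₀
    refine ⟨S, A, hS, hA0, max L₁ L₂, fun L _ hL hE ψ hψ hgs m hm0 => ?_⟩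
    exact profile_of_shape_of_flat hS hA0 (pairStructureFactor dWaveFormFactor L ψ)
      (hshape L (le_of_max_le_left hL) hE ψ hψ hgs) (hflat L (le_of_max_le_right hL) hE ψ hψ hgs) hm0

/-! ### (A) ⟺ the window-free Goldstone shape -/

/-- **(A) is exactly (GS) with the window removed.** Since `|q_m| ≤ π√2` on the torus
(`momentumNormSq_le_two_mul_pi_sq`), the profile `S_ψ(m) ≤ S + A/|q_m|` (`m ≠ 0`) is equivalent to the
GLOBAL Goldstone shape `S_ψ(m)·|q_m| ≤ A'` for all `m ≠ 0` (`A' = S·√(2π²) + A`; conversely `S = 0`).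
So sub-crux (A) is the hypothesis of `wib_of_goldstoneShape` strengthened from a window `|q_m| ≤ ε₀` to ALL
nonzero momenta — strictly above (GS), itself strictly above the Σ-form crux `WindowInfraredBound`. [folklore] -/
theorem goldstonePairProfile_iff_globalShape :
    (∀ U : ℝ, 0 < U → ∀ δ ∈ Set.Ioo (0:ℝ) (1 / 2), ∃ S A : ℝ, 0 ≤ S ∧ 0 ≤ A ∧ ∃ L₀ : ℕ,
      ∀ (L : ℕ) [NeZero L], L₀ ≤ L → Even L →
        ∀ ψ : Fock (Orb (FermionTorus 2 L)), star ψ ⬝ᵥ ψ = 1 →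
          IsGroundStateInSector (hubbardTorus 2 L 1 U) (2 * ⌊(1 - δ) * (L : ℝ) ^ 2 / 2⌋₊) 0 ψ →
            ∀ m : TorusSite 2 L, m ≠ 0 →
              pairStructureFactor dWaveFormFactor L ψ m ≤ S + A / Real.sqrt (momentumNormSq L m)) ↔
    (∀ U : ℝ, 0 < U → ∀ δ ∈ Set.Ioo (0:ℝ) (1 / 2), ∃ A : ℝ, 0 ≤ A ∧ ∃ L₀ : ℕ,
      ∀ (L : ℕ) [NeZero L], L₀ ≤ L → Even L →
        ∀ ψ : Fock (Orb (FermionTorus 2 L)), star ψ ⬝ᵥ ψ = 1 →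
          IsGroundStateInSector (hubbardTorus 2 L 1 U) (2 * ⌊(1 - δ) * (L : ℝ) ^ 2 / 2⌋₊) 0 ψ →
            ∀ m : TorusSite 2 L, m ≠ 0 →
              pairStructureFactor dWaveFormFactor L ψ m * Real.sqrt (momentumNormSq L m) ≤ A) := by
  constructor
  · intro hA U hU δ hδ
    obtain ⟨S, A, hS, hA0, L₀, hprof⟩ := hA U hU δ hδ
    refine ⟨S * Real.sqrt (2 * Real.pi ^ 2) + A, by positivity, L₀,
      fun L _ hL hE ψ hψ hgs m hm0 => ?_⟩
    refine mul_sqrt_le_of_profile hS (Real.sqrt_nonneg _) (pairStructureFactor dWaveFormFactor L ψ) hm0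
      ?_ (hprof L hL hE ψ hψ hgs m hm0)
    rw [Real.sq_sqrt (by positivity)]
    exact momentumNormSq_le_two_mul_pi_sq m
  · intro hG U hU δ hδ
    obtain ⟨A, hA0, L₀, hshape⟩ := hG U hU δ hδ
    refine ⟨0, A, le_rfl, hA0, L₀, fun L _ hL hE ψ hψ hgs m hm0 => ?_⟩
    have hr := sqrt_momentumNormSq_pos hm0
    have h := hshape L hL hE ψ hψ hgs m hm0
    rw [← le_div_iff₀ hr] at h
    linarith

/-! ### The open hypotheses (A) hinges on, by name -/

/-- **C⁺_λ → (Ch) → (OffWindowFlat) → (A).** The two OPEN physics stubs of the stmt-1089 line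
`pair-gaussian-domination-energy-form` — `stub_pairGaussianDomination` (C⁺_λ, the `λ_q`-regularised
own-bottom energy-form pair-channel Gaussian domination) and `stub_chargingFloor` ((Ch), `pairGap ≥ -κ/L`),
both VERBATIM — give (GS) by the landed engine
`WindowInfraredBound.goldstoneShape_of_pairGaussianDomination_of_chargingFloor`; adding the off-window flat
law (OffWindowFlat) yields sub-crux (A) by `goldstonePairProfile_iff_shape_and_flat`. These three are the
exact unproved inputs of (A) on the current tree. Kennedy–Lieb–Shastry (1988); Pitaevskii–Stringari (1991).
[folklore] -/
theorem goldstonePairProfile_of_pgd_of_chargingFloor_of_offWindowFlat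
    (hGD : ∀ U : ℝ, 0 < U → ∀ δ ∈ Set.Ioo (0:ℝ) (1 / 2), ∃ C_χ c₀ η : ℝ, 0 ≤ C_χ ∧ 0 ≤ c₀ ∧ 0 < η ∧
      ∃ L₀ : ℕ, ∀ (L : ℕ) [NeZero L], L₀ ≤ L → Even L → ∀ m : TorusSite 2 L, m ≠ 0 →
        momentumNormSq L m ≤ η ^ 2 → ∀ t : ℝ,
          ((hubbardTorus 2 L 1 U).minEnergyOn (szSector (2 * ⌊(1 - δ) * (L : ℝ) ^ 2 / 2⌋₊) 0) -
              ((hubbardTorus 2 L 1 U).minEnergyOn (szSector (2 * ⌊(1 - δ) * (L : ℝ) ^ 2 / 2⌋₊) 0) -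
                  (hubbardTorus 2 L 1 U).minEnergyOn (szSector (2 * ⌊(1 - δ) * (L : ℝ) ^ 2 / 2⌋₊ - 2) 0) +
                  c₀ * momentumNormSq L m) / 2 * ((2 * ⌊(1 - δ) * (L : ℝ) ^ 2 / 2⌋₊ : ℕ) : ℝ) -
              C_χ * (L : ℝ) ^ 2 / momentumNormSq L m * t ^ 2 ≤
            (hubbardTorus 2 L 1 U -
              ((((hubbardTorus 2 L 1 U).minEnergyOn (szSector (2 * ⌊(1 - δ) * (L : ℝ) ^ 2 / 2⌋₊) 0) -
                  (hubbardTorus 2 L 1 U).minEnergyOn (szSector (2 * ⌊(1 - δ) * (L : ℝ) ^ 2 / 2⌋₊ - 2) 0) +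
                  c₀ * momentumNormSq L m) / 2 : ℝ) : ℂ) •
                (totalNumber : Matrix (Finset (Orb (FermionTorus 2 L))) (Finset (Orb (FermionTorus 2 L))) ℂ) -
              (t : ℂ) • (pairFieldAt dWaveFormFactor L m + (pairFieldAt dWaveFormFactor L m)ᴴ)).minEnergyOn
              (szSector (2 * ⌊(1 - δ) * (L : ℝ) ^ 2 / 2⌋₊ - 2) 0 ⊔
                szSector (2 * ⌊(1 - δ) * (L : ℝ) ^ 2 / 2⌋₊) 0)) ∧
          ((hubbardTorus 2 L 1 U).minEnergyOn (szSector (2 * ⌊(1 - δ) * (L : ℝ) ^ 2 / 2⌋₊) 0) -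
              ((hubbardTorus 2 L 1 U).minEnergyOn (szSector (2 * ⌊(1 - δ) * (L : ℝ) ^ 2 / 2⌋₊ + 2) 0) -
                  (hubbardTorus 2 L 1 U).minEnergyOn (szSector (2 * ⌊(1 - δ) * (L : ℝ) ^ 2 / 2⌋₊) 0) -
                  c₀ * momentumNormSq L m) / 2 * ((2 * ⌊(1 - δ) * (L : ℝ) ^ 2 / 2⌋₊ : ℕ) : ℝ) -
              C_χ * (L : ℝ) ^ 2 / momentumNormSq L m * t ^ 2 ≤
            (hubbardTorus 2 L 1 U -
              ((((hubbardTorus 2 L 1 U).minEnergyOn (szSector (2 * ⌊(1 - δ) * (L : ℝ) ^ 2 / 2⌋₊ + 2) 0) -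
                  (hubbardTorus 2 L 1 U).minEnergyOn (szSector (2 * ⌊(1 - δ) * (L : ℝ) ^ 2 / 2⌋₊) 0) -
                  c₀ * momentumNormSq L m) / 2 : ℝ) : ℂ) •
                (totalNumber : Matrix (Finset (Orb (FermionTorus 2 L))) (Finset (Orb (FermionTorus 2 L))) ℂ) -
              (t : ℂ) • (pairFieldAt dWaveFormFactor L m + (pairFieldAt dWaveFormFactor L m)ᴴ)).minEnergyOn
              (szSector (2 * ⌊(1 - δ) * (L : ℝ) ^ 2 / 2⌋₊) 0 ⊔
                szSector (2 * ⌊(1 - δ) * (L : ℝ) ^ 2 / 2⌋₊ + 2) 0)))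
    (hCh : ∀ U : ℝ, 0 < U → ∀ δ ∈ Set.Ioo (0:ℝ) (1 / 2), ∃ κ : ℝ, 0 ≤ κ ∧ ∃ L₀ : ℕ, ∀ (L : ℕ) [NeZero L],
      L₀ ≤ L → Even L → -(κ / (L : ℝ)) ≤ pairGap (hubbardTorus 2 L 1 U) (2 * ⌊(1 - δ) * (L : ℝ) ^ 2 / 2⌋₊))
    (hFlat : ∀ U : ℝ, 0 < U → ∀ δ ∈ Set.Ioo (0:ℝ) (1 / 2), ∀ η : ℝ, 0 < η → ∃ S : ℝ, 0 ≤ S ∧ ∃ L₀ : ℕ,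
      ∀ (L : ℕ) [NeZero L], L₀ ≤ L → Even L → ∀ ψ : Fock (Orb (FermionTorus 2 L)),
        star ψ ⬝ᵥ ψ = 1 →
          IsGroundStateInSector (hubbardTorus 2 L 1 U) (2 * ⌊(1 - δ) * (L : ℝ) ^ 2 / 2⌋₊) 0 ψ →
            ∀ m : TorusSite 2 L, η ^ 2 < momentumNormSq L m →
              pairStructureFactor dWaveFormFactor L ψ m ≤ S) :
    ∀ U : ℝ, 0 < U → ∀ δ ∈ Set.Ioo (0:ℝ) (1 / 2), ∃ S A : ℝ, 0 ≤ S ∧ 0 ≤ A ∧ ∃ L₀ : ℕ,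
      ∀ (L : ℕ) [NeZero L], L₀ ≤ L → Even L →
        ∀ ψ : Fock (Orb (FermionTorus 2 L)), star ψ ⬝ᵥ ψ = 1 →
          IsGroundStateInSector (hubbardTorus 2 L 1 U) (2 * ⌊(1 - δ) * (L : ℝ) ^ 2 / 2⌋₊) 0 ψ →
            ∀ m : TorusSite 2 L, m ≠ 0 →
              pairStructureFactor dWaveFormFactor L ψ m ≤ S + A / Real.sqrt (momentumNormSq L m) :=
  goldstonePairProfile_iff_shape_and_flat.2
    ⟨WindowInfraredBound.goldstoneShape_of_pairGaussianDomination_of_chargingFloor hGD hCh, hFlat⟩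

/-- **Zone-wide C⁺_λ → (Ch) → (A).** If the energy-form pair-channel Gaussian domination C⁺_λ
(`stub_pairGaussianDomination` with its window clause `momentumNormSq L m ≤ η ^ 2` DROPPED: every nonzero
momentum label, all real `t`) and the charging floor (Ch) (`stub_chargingFloor`, verbatim) hold, then sub-crux
(A) holds with `S = 0`, `A = 2√((C₁ + C₃C₂)C_χ) + 2κC_χ/π + 2c₀C_χ√(2π²)`. Proof = the body of the landed engine
`WindowInfraredBound.goldstoneShape_of_pairGaussianDomination_of_chargingFloor` run at the zone-covering window
`η := √(2π²)` (`momentumNormSq_le_two_mul_pi_sq`): first variation (`stub_pgdFirstVariation`, p96685), landed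
budgets F1/F2/F3 (`stub_doubleCommBound` at `μ = 0`, `WcbcsSsbToTorusLRO.stub_pairCommutatorBudget`,
`wib_twoParticleCost_holds`), pointwise closure `goldstoneShape_of_regularisedClosure`; then
`goldstonePairProfile_iff_globalShape`. Kennedy–Lieb–Shastry (1988) eqs. (17)–(19); Pitaevskii–Stringari (1991).
[folklore] -/
theorem goldstonePairProfile_of_globalPgd_of_chargingFloor
    (hGD : ∀ U : ℝ, 0 < U → ∀ δ ∈ Set.Ioo (0:ℝ) (1 / 2), ∃ C_χ c₀ : ℝ, 0 ≤ C_χ ∧ 0 ≤ c₀ ∧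
      ∃ L₀ : ℕ, ∀ (L : ℕ) [NeZero L], L₀ ≤ L → Even L → ∀ m : TorusSite 2 L, m ≠ 0 → ∀ t : ℝ,
          ((hubbardTorus 2 L 1 U).minEnergyOn (szSector (2 * ⌊(1 - δ) * (L : ℝ) ^ 2 / 2⌋₊) 0) -
              ((hubbardTorus 2 L 1 U).minEnergyOn (szSector (2 * ⌊(1 - δ) * (L : ℝ) ^ 2 / 2⌋₊) 0) -
                  (hubbardTorus 2 L 1 U).minEnergyOn (szSector (2 * ⌊(1 - δ) * (L : ℝ) ^ 2 / 2⌋₊ - 2) 0) +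
                  c₀ * momentumNormSq L m) / 2 * ((2 * ⌊(1 - δ) * (L : ℝ) ^ 2 / 2⌋₊ : ℕ) : ℝ) -
              C_χ * (L : ℝ) ^ 2 / momentumNormSq L m * t ^ 2 ≤
            (hubbardTorus 2 L 1 U -
              ((((hubbardTorus 2 L 1 U).minEnergyOn (szSector (2 * ⌊(1 - δ) * (L : ℝ) ^ 2 / 2⌋₊) 0) -
                  (hubbardTorus 2 L 1 U).minEnergyOn (szSector (2 * ⌊(1 - δ) * (L : ℝ) ^ 2 / 2⌋₊ - 2) 0) +
                  c₀ * momentumNormSq L m) / 2 : ℝ) : ℂ) •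
                (totalNumber : Matrix (Finset (Orb (FermionTorus 2 L))) (Finset (Orb (FermionTorus 2 L))) ℂ) -
              (t : ℂ) • (pairFieldAt dWaveFormFactor L m + (pairFieldAt dWaveFormFactor L m)ᴴ)).minEnergyOn
              (szSector (2 * ⌊(1 - δ) * (L : ℝ) ^ 2 / 2⌋₊ - 2) 0 ⊔
                szSector (2 * ⌊(1 - δ) * (L : ℝ) ^ 2 / 2⌋₊) 0)) ∧
          ((hubbardTorus 2 L 1 U).minEnergyOn (szSector (2 * ⌊(1 - δ) * (L : ℝ) ^ 2 / 2⌋₊) 0) -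
              ((hubbardTorus 2 L 1 U).minEnergyOn (szSector (2 * ⌊(1 - δ) * (L : ℝ) ^ 2 / 2⌋₊ + 2) 0) -
                  (hubbardTorus 2 L 1 U).minEnergyOn (szSector (2 * ⌊(1 - δ) * (L : ℝ) ^ 2 / 2⌋₊) 0) -
                  c₀ * momentumNormSq L m) / 2 * ((2 * ⌊(1 - δ) * (L : ℝ) ^ 2 / 2⌋₊ : ℕ) : ℝ) -
              C_χ * (L : ℝ) ^ 2 / momentumNormSq L m * t ^ 2 ≤
            (hubbardTorus 2 L 1 U -
              ((((hubbardTorus 2 L 1 U).minEnergyOn (szSector (2 * ⌊(1 - δ) * (L : ℝ) ^ 2 / 2⌋₊ + 2) 0) -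
                  (hubbardTorus 2 L 1 U).minEnergyOn (szSector (2 * ⌊(1 - δ) * (L : ℝ) ^ 2 / 2⌋₊) 0) -
                  c₀ * momentumNormSq L m) / 2 : ℝ) : ℂ) •
                (totalNumber : Matrix (Finset (Orb (FermionTorus 2 L))) (Finset (Orb (FermionTorus 2 L))) ℂ) -
              (t : ℂ) • (pairFieldAt dWaveFormFactor L m + (pairFieldAt dWaveFormFactor L m)ᴴ)).minEnergyOn
              (szSector (2 * ⌊(1 - δ) * (L : ℝ) ^ 2 / 2⌋₊) 0 ⊔
                szSector (2 * ⌊(1 - δ) * (L : ℝ) ^ 2 / 2⌋₊ + 2) 0)))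
    (hCh : ∀ U : ℝ, 0 < U → ∀ δ ∈ Set.Ioo (0:ℝ) (1 / 2), ∃ κ : ℝ, 0 ≤ κ ∧ ∃ L₀ : ℕ, ∀ (L : ℕ) [NeZero L],
      L₀ ≤ L → Even L → -(κ / (L : ℝ)) ≤ pairGap (hubbardTorus 2 L 1 U) (2 * ⌊(1 - δ) * (L : ℝ) ^ 2 / 2⌋₊)) :
    ∀ U : ℝ, 0 < U → ∀ δ ∈ Set.Ioo (0:ℝ) (1 / 2), ∃ S A : ℝ, 0 ≤ S ∧ 0 ≤ A ∧ ∃ L₀ : ℕ,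
      ∀ (L : ℕ) [NeZero L], L₀ ≤ L → Even L →
        ∀ ψ : Fock (Orb (FermionTorus 2 L)), star ψ ⬝ᵥ ψ = 1 →
          IsGroundStateInSector (hubbardTorus 2 L 1 U) (2 * ⌊(1 - δ) * (L : ℝ) ^ 2 / 2⌋₊) 0 ψ →
            ∀ m : TorusSite 2 L, m ≠ 0 →
              pairStructureFactor dWaveFormFactor L ψ m ≤ S + A / Real.sqrt (momentumNormSq L m) := by
  -- adapted from `WindowInfraredBound.goldstoneShape_of_pairGaussianDomination_of_chargingFloor` (η := √(2π²))
  refine goldstonePairProfile_iff_globalShape.2 fun U hU δ hδ => ?_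
  obtain ⟨η, hη, hηsq⟩ : ∃ η : ℝ, 0 < η ∧ η ^ 2 = 2 * Real.pi ^ 2 :=
    ⟨Real.sqrt (2 * Real.pi ^ 2), Real.sqrt_pos.2 (by positivity), Real.sq_sqrt (by positivity)⟩
  obtain ⟨C_X, c₀, hCX, hc₀, L₁, hGD⟩ := hGD U hU δ hδ
  obtain ⟨κ, hκ, L₂, hCh⟩ := hCh U hU δ hδ
  obtain ⟨C₃, hC₃, L₃, hF3⟩ := wib_twoParticleCost_holds U hU δ hδ
  obtain ⟨C, hC, hB⟩ := stub_doubleCommBound U hU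
  obtain ⟨B, hB0, hPCB⟩ := WcbcsSsbToTorusLRO.stub_pairCommutatorBudget
  refine ⟨2 * Real.sqrt ((C + C₃ * B) * C_X) + 2 * κ * C_X / Real.pi + 2 * c₀ * C_X * η,
    by positivity, max (max L₁ L₂) (max L₃ 2), fun L _ hL₀ hev ψ hψ1 hψ m hm0 => ?_⟩
  have hL₁ : L₁ ≤ L := le_trans (le_max_left _ _) ((le_max_left _ _).trans hL₀)
  have hL₂ : L₂ ≤ L := le_trans (le_max_right _ _) ((le_max_left _ _).trans hL₀)
  have hL₃ : L₃ ≤ L := le_trans (le_max_left _ _) ((le_max_right _ _).trans hL₀)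
  have hL2 : 2 ≤ L := le_trans (le_max_right _ _) ((le_max_right _ _).trans hL₀)
  have hN : 2 ≤ 2 * ⌊(1 - δ) * (L : ℝ) ^ 2 / 2⌋₊ := wib_two_le_summitFilling hδ hL2
  -- the zone-covering window: `|q_m|² ≤ 2π² = η²` for every label
  have hmη : momentumNormSq L m ≤ η ^ 2 := hηsq ▸ momentumNormSq_le_two_mul_pi_sq m
  -- zone-wide C⁺_λ at this `L`, `m`, all `t`; first variation (p96685) ⇒ (T_λ∓)
  have hGD' := hGD L hL₁ hev m hm0
  obtain ⟨hTm, hTp⟩ := WindowInfraredBound.stub_pgdFirstVariation L U (2 * ⌊(1 - δ) * (L : ℝ) ^ 2 / 2⌋₊) hN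
    ψ hψ hψ1 m (C_X * (L : ℝ) ^ 2 / momentumNormSq L m) (c₀ * momentumNormSq L m)
  have hTm' := hTm (fun t => (hGD' t).1)
  have hTp' := hTp (fun t => (hGD' t).2)
  -- (F1) at `μ = 0`
  have hF1 : (star ψ ⬝ᵥ (((pairFieldAt dWaveFormFactor L m)ᴴ *
        (hubbardTorus 2 L 1 U * pairFieldAt dWaveFormFactor L m -
          pairFieldAt dWaveFormFactor L m * hubbardTorus 2 L 1 U) -
        (hubbardTorus 2 L 1 U * pairFieldAt dWaveFormFactor L m -
          pairFieldAt dWaveFormFactor L m * hubbardTorus 2 L 1 U) *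
        (pairFieldAt dWaveFormFactor L m)ᴴ) *ᵥ ψ)).re ≤ C * (L : ℝ) ^ 2 := by
    have h := hB L 0 m ψ
    rw [hubbardTorusWith_zero, hψ1, Complex.one_re, mul_one, abs_zero, add_zero, mul_one] at h
    exact (le_abs_self _).trans h
  -- (F2)
  have hF2 : |(star ψ ⬝ᵥ (((pairFieldAt dWaveFormFactor L m)ᴴ * pairFieldAt dWaveFormFactor L m -
        pairFieldAt dWaveFormFactor L m * (pairFieldAt dWaveFormFactor L m)ᴴ) *ᵥ ψ)).re| ≤
        B * (L : ℝ) ^ 2 := by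
    have h := hPCB L m ψ
    rwa [hψ1, Complex.one_re, mul_one] at h
  exact WindowInfraredBound.goldstoneShape_of_regularisedClosure hN hψ hψ1 hm0 hCX hC hB0 hC₃ hκ hc₀ hmη hη
    hTm' hTp' hF1 hF2 (hF3 L hL₃ hev) (hCh L hL₂ hev)

/-- **Registered form of the glue** (`goldstonePairProfileIffShapeAndFlat`, stub of stmt-7331, line
`pointwise_split`): the one-line verbatim signature (A) ⟺ (GS) ∧ (OffWindowFlat), by
`goldstonePairProfile_iff_shape_and_flat`. [folklore] -/
theorem goldstonePairProfileIffShapeAndFlat : (∀ U : ℝ, 0 < U → ∀ δ ∈ Set.Ioo (0:ℝ) (1 / 2), ∃ S A : ℝ, 0 ≤ S ∧ 0 ≤ A ∧ ∃ L₀ : ℕ, ∀ (L : ℕ) [NeZero L], L₀ ≤ L → Even L → ∀ ψ : Fock (Orb (FermionTorus 2 L)), star ψ ⬝ᵥ ψ = 1 → IsGroundStateInSector (hubbardTorus 2 L 1 U) (2 * ⌊(1 - δ) * (L : ℝ) ^ 2 / 2⌋₊) 0 ψ → ∀ m : TorusSite 2 L, m ≠ 0 → pairStructureFactor dWaveFormFactor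 L ψ m ≤ S + A / Real.sqrt (momentumNormSq L m)) ↔ ((∀ U : ℝ, 0 < U → ∀ δ ∈ Set.Ioo (0:ℝ) (1 / 2), ∃ A ε₀ : ℝ, 0 ≤ A ∧ 0 < ε₀ ∧ ∃ L₀ : ℕ, ∀ (L : ℕ) [NeZero L], L₀ ≤ L → Even L → ∀ ψ : Fock (Orb (FermionTorus 2 L)), star ψ ⬝ᵥ ψ = 1 → IsGroundStateInSector (hubbardTorus 2 L 1 U) (2 * ⌊(1 - δ) * (L : ℝ) ^ 2 / 2⌋₊) 0 ψ → ∀ m : TorusSite 2 L, m ≠ 0 → momentumNormSq L m ≤ ε₀ ^ 2 → pairStructureFactor dWaveFormFactor L ψ m * Real.sqrt (momentumNormSq L m) ≤ A) ∧ (∀ U : ℝ, 0 < U → ∀ δ ∈ Set.Ioo (0:ℝ) (1 / 2), ∀ η : ℝ, 0 < η → ∃ S : ℝ, 0 ≤ S ∧ ∃ L₀ : ℕ, ∀ (L : ℕ) [NeZero L], L₀ ≤ L → Even L → ∀ ψ : Fock (Orb (FermionTorus 2 L)), star ψ ⬝ᵥ ψ = 1 → IsGroundStateInSector (hubbardTorus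 2 L 1 U) (2 * ⌊(1 - δ) * (L : ℝ) ^ 2 / 2⌋₊) 0 ψ → ∀ m : TorusSite 2 L, η ^ 2 < momentumNormSq L m → pairStructureFactor dWaveFormFactor L ψ m ≤ S)) :=
  goldstonePairProfile_iff_shape_and_flat

end Summit.HubbardSuperconductivity.HubbardSuperconductivity.Theorems.FunctionFieldCertificate
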